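import Mathlib.RingTheory.MvPowerSeries.Substitution
import Mathlib.Data.Matrix.Mul
import Mathlib.LinearAlgebra.Matrix.NonsingularInverse
import Literature.AlgebraicGeometry.Resolution.QuadraticTransforms
import Literature.AlgebraicGeometry.Resolution.PowerSeriesRegularLocal
import Literature.RingTheory.MvPowerSeries.MaximalIdealPow
import HarnessLib

/-!
# Crux `Steer` (stmt-16345), chain W4.1 — dictionary piece T2 `chart_step`, file 2/4: the POINT of the
# exceptional divisor selected by the valuation, and the typed blow-up substitution `Φ_{j,τ}`

OURS (campaign `res-hironaka`, rung L, slot W4.1; helper toward the registered stub `stub_core4Iso` of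
reshape r8 of line `switching_dichotomy`, lead res-L0-w41-lead-1's `DICT-SIGS.lean` piece T2 = seam T2a;
replaces the role of no printed item; NOT a statement of the manuscript under review; AI-produced).
Theses-free (imports `Literature` + Mathlib only; chain build rule).

Setting: a FORMAL CHART `φ : R → κ⟦X_1..X_d⟧` of a subring `R ⊆ O` of the valued field `(K, O)`, i.e.
(FC1) constant coefficients are residues (`constantCoeff (φ r) = ι (res r)`, `ι : κ(O) → κ`) and (FC2) the
centre `𝔠 = 𝔪_O ∩ R` generates `(X_1, …, X_d)`; generators `u_1, …, u_d` of `𝔠`; an element `x` dividing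
`𝔠` inside `O` (the exceptional parameter of the quadratic transform).

* `coeff_single_mul`, `coeff_single_sum_mul`, `coeff_single_X` — linear coefficients `[X_s]G`
  (`= constantCoeff (∂G/∂X_s)`, so Leibniz).
* `exists_point` (**T2a**) — there is `ξ ∈ κ^d` with `Σ_l [X_l](φ y) · ξ_l = ι res(y/x)` for all `y ∈ 𝔠`:
  by FC2 the matrix `M_{ml} = [X_l](φ u_m)` has a left inverse `C` (read `X_l ∈ (φ u_m)_m` on linear
  parts), hence is invertible (`mul_eq_one_comm`), and `ξ := C · (ι res(u_m/x))_m`; a general `y = Σ r_m u_m`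
  has linear part `Σ res(r_m) M_m` (FC1) and `res(y/x) = Σ res(r_m) res(u_m/x)`. In particular
  `Σ_l [X_l](φ x) ξ_l = res(x/x) = 1`, so `ξ ≠ 0`: `ξ` is the point of the exceptional divisor `ℙ(𝔪/𝔪²)(κ)`
  through which `O` passes, in the chart's coordinates (no rationality of the centre is needed: `κ` only
  receives the residue field of `O`).
* The typed substitution `Φ_{j,τ}(X_j) = X_j`, `Φ_{j,τ}(X_s) = X_j (X_s + τ_s)` (literally the family of
  `Theorems.WildCones.MuDropCharTwoOrdP.blowFam` / `NarrowRunsDie.stub_dict`, restated inline):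
  `hasSubst_blowFam`; `exists_subst_blowFam_eq` (**`σ G = G(0) + X_j · H`**: everything moves into `(X_j)`
  up to the constant term), `constantCoeff_subst_blowFam`; `exists_subst_blowFam_eq_X_mul` (for `G ∈ (X)`:
  **`σ G = X_j · W` with `W ≡ Σ_l [X_l]G · Θ_l (mod X_j)`**, `Θ_j = 1`, `Θ_s = X_s + τ_s`) — the strict
  transform of a hypersurface through the centre and its tangent data at the new origin.

Sources: standard (charts of a point blow-up; e.g. H. Hauser, S. Perlega, arXiv:1802.05010 §3 for the
transformation rules in exactly this coordinate form); folklore commutative algebra. No definitions.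
-/

-- layout-mandated namespace `Summit.<Summit>.<Problem>.…` with Summit = Problem (single-conjunct summit)
set_option linter.dupNamespace false

open IsLocalRing MvPowerSeries
open Literature.AlgebraicGeometry.Resolution

namespace Summit.ResolutionOfSingularities.ResolutionOfSingularities.Theorems.SwitchingDichotomy

namespace ChartStep

/-! ## Linear coefficients -/

section Linear

variable {d : ℕ} {κ : Type*} [Field κ]

/-- The linear coefficient along `X_s` is the constant coefficient of `∂/∂X_s`. [folklore] -/
theorem coeff_single_eq_constantCoeff_pderiv (s : Fin d) (G : MvPowerSeries (Fin d) κ) :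
    coeff (Finsupp.single s 1) G = constantCoeff (MvPowerSeries.pderiv s G) := by
  rw [← coeff_zero_eq_constantCoeff_apply, MvPowerSeries.coeff_pderiv]
  simp

/-- Leibniz for linear coefficients: `[X_s](A·B) = A(0)·[X_s]B + [X_s]A·B(0)`. [folklore] -/
theorem coeff_single_mul (s : Fin d) (A B : MvPowerSeries (Fin d) κ) :
    coeff (Finsupp.single s 1) (A * B) =
      constantCoeff A * coeff (Finsupp.single s 1) B + coeff (Finsupp.single s 1) A * constantCoeff B := by
  simp only [coeff_single_eq_constantCoeff_pderiv, Derivation.leibniz, smul_eq_mul, map_add, map_mul]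
  ring

/-- Linear coefficients of a variable. [folklore] -/
theorem coeff_single_X (s l : Fin d) :
    coeff (Finsupp.single s 1) (X l : MvPowerSeries (Fin d) κ) = if l = s then 1 else 0 := by
  rw [coeff_X]
  by_cases h : l = s
  · subst h; simp
  · rw [if_neg, if_neg h]
    intro heq
    exact h ((Finsupp.single_left_inj one_ne_zero).mp heq).symm

/-- Linear coefficients of a combination `Σ_m c_m · G_m` with all `G_m(0) = 0`. [folklore] -/
theorem coeff_single_sum_mul (s : Fin d) (c G : Fin d → MvPowerSeries (Fin d) κ)
    (hG : ∀ m, constantCoeff (G m) = 0) :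
    coeff (Finsupp.single s 1) (∑ m, c m * G m) = ∑ m, constantCoeff (c m) * coeff (Finsupp.single s 1) (G m) := by
  rw [map_sum]
  refine Finset.sum_congr rfl fun m _ => ?_
  rw [coeff_single_mul, hG m, mul_zero, add_zero]

end Linear

/-! ## The typed blow-up substitution `Φ_{j,τ}` -/

section BlowFam

variable {d : ℕ} {κ : Type*} [Field κ] (j : Fin d) (τ : Fin d → κ)

/-- `Φ_{j,τ}` is substitutable (all constant coefficients vanish). [folklore] -/
theorem hasSubst_blowFam :
    HasSubst (fun s : Fin d => if s = j then (X j : MvPowerSeries (Fin d) κ) else X j * (X s + C (τ s))) := by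
  refine hasSubst_of_constantCoeff_zero fun s => ?_
  by_cases h : s = j
  · simp [h]
  · simp [h]

/-- Every member of `Φ_{j,τ}` is `X_j · Θ_s` with `Θ_j = 1`, `Θ_s = X_s + τ_s`. [folklore] -/
theorem blowFam_eq_X_mul (s : Fin d) :
    (if s = j then (X j : MvPowerSeries (Fin d) κ) else X j * (X s + C (τ s))) =
      X j * (if s = j then (1 : MvPowerSeries (Fin d) κ) else X s + C (τ s)) := by
  by_cases h : s = j
  · simp [h]
  · simp [h]

/-- **`Φ_{j,τ}` moves everything into `(X_j)` up to the constant term**: `σ G = G(0) + X_j · H`.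
[folklore] -/
theorem exists_subst_blowFam_eq (G : MvPowerSeries (Fin d) κ) :
    ∃ H : MvPowerSeries (Fin d) κ,
      subst (fun s : Fin d => if s = j then (X j : MvPowerSeries (Fin d) κ) else X j * (X s + C (τ s))) G =
        C (constantCoeff G) + X j * H := by
  classical
  have hs := hasSubst_blowFam j τ
  -- `G = C (G 0) + G'`, `G' ∈ (X)`
  have hG' : G - C (constantCoeff G) ∈ Ideal.span (Set.range (X : Fin d → MvPowerSeries (Fin d) κ)) := by
    rw [← maximalIdeal_mvPowerSeries_eq_span,
      Literature.RingTheory.MvPowerSeries.Jets.mem_maximalIdeal_iff_constantCoeff_eq_zero]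
    simp
  obtain ⟨c, hc⟩ := Ideal.mem_span_range_iff_exists_fun.mp hG'
  refine ⟨∑ l, (if l = j then (1 : MvPowerSeries (Fin d) κ) else X l + C (τ l)) *
    subst (fun s : Fin d => if s = j then (X j : MvPowerSeries (Fin d) κ) else X j * (X s + C (τ s))) (c l), ?_⟩
  have hGeq : G = C (constantCoeff G) + ∑ l, c l * X l := by rw [hc]; ring
  conv_lhs => rw [hGeq]
  rw [← coe_substAlgHom hs, map_add, map_sum]
  simp only [map_mul, coe_substAlgHom, subst_X hs, Finset.mul_sum]
  congr 1
  · rw [← coe_substAlgHom hs]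
    exact (substAlgHom hs).commutes (constantCoeff G)
  · refine Finset.sum_congr rfl fun l _ => ?_
    rw [blowFam_eq_X_mul j τ l]; ring

/-- Hence `σ G ≡ G(0) (mod X_j)` and `σ` preserves constant coefficients. [folklore] -/
theorem constantCoeff_subst_blowFam (G : MvPowerSeries (Fin d) κ) :
    constantCoeff (subst (fun s : Fin d => if s = j then (X j : MvPowerSeries (Fin d) κ)
      else X j * (X s + C (τ s))) G) = constantCoeff G := by
  obtain ⟨H, hH⟩ := exists_subst_blowFam_eq j τ G
  rw [hH, map_add, map_mul, constantCoeff_C, constantCoeff_X, zero_mul, add_zero]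

/-- **The transform of a series in `(X)`**: if `G = Σ_l X_l H_l` then `σ G = X_j · W` with
`W = Σ_l Θ_l · σ H_l`, and `W ≡ Σ_l [X_l]G · Θ_l (mod X_j)` where `[X_l]G` is the linear coefficient.
[folklore] -/
theorem exists_subst_blowFam_eq_X_mul (G : MvPowerSeries (Fin d) κ) (hG : constantCoeff G = 0) :
    ∃ W H : MvPowerSeries (Fin d) κ,
      subst (fun s : Fin d => if s = j then (X j : MvPowerSeries (Fin d) κ) else X j * (X s + C (τ s))) G =
        X j * W ∧
      W = (∑ l, C (coeff (Finsupp.single l 1) G) *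
            (if l = j then (1 : MvPowerSeries (Fin d) κ) else X l + C (τ l))) + X j * H := by
  classical
  have hs := hasSubst_blowFam j τ
  have hGm : G ∈ Ideal.span (Set.range (X : Fin d → MvPowerSeries (Fin d) κ)) := by
    rw [← maximalIdeal_mvPowerSeries_eq_span,
      Literature.RingTheory.MvPowerSeries.Jets.mem_maximalIdeal_iff_constantCoeff_eq_zero, hG]
  obtain ⟨c, hc⟩ := Ideal.mem_span_range_iff_exists_fun.mp hGm
  -- `σ (c l) = c l (0) + X_j · (H' l)`
  choose H' hH' using fun l => exists_subst_blowFam_eq j τ (c l)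
  refine ⟨∑ l, (if l = j then (1 : MvPowerSeries (Fin d) κ) else X l + C (τ l)) *
      subst (fun s : Fin d => if s = j then (X j : MvPowerSeries (Fin d) κ) else X j * (X s + C (τ s))) (c l),
    ∑ l, (if l = j then (1 : MvPowerSeries (Fin d) κ) else X l + C (τ l)) * H' l, ?_, ?_⟩
  · rw [← hc, ← coe_substAlgHom hs, map_sum]
    simp only [map_mul, coe_substAlgHom, subst_X hs, Finset.mul_sum]
    refine Finset.sum_congr rfl fun l _ => ?_
    rw [blowFam_eq_X_mul j τ l]; ring
  · -- linear coefficients of `G = Σ c_l X_l` are the `c_l(0)`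
    have hlin : ∀ l, coeff (Finsupp.single l 1) G = constantCoeff (c l) := by
      intro l
      rw [← hc, coeff_single_sum_mul l c (fun m => X m) (fun m => constantCoeff_X m)]
      simp only [coeff_single_X, mul_ite, mul_one, mul_zero, Finset.sum_ite_eq', Finset.mem_univ,
        if_true]
    simp only [hlin, Finset.mul_sum, ← Finset.sum_add_distrib]
    refine Finset.sum_congr rfl fun l _ => ?_
    rw [hH' l]; ring

end BlowFam

/-! ## The point of the exceptional divisor selected by `O` (T2a) -/

section Point

variable {K : Type*} [Field K] (O : ValuationSubring K) {κ : Type*} [Field κ]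
  (ι : IsLocalRing.ResidueField O →+* κ) {R : Subring K} (hR : R ≤ O.toSubring)
  {d : ℕ} (φ : R →+* MvPowerSeries (Fin d) κ)

/-- (FC1) ⇒ elements of the centre go to series without constant term. [folklore] -/
theorem constantCoeff_eq_zero_of_mem_centre
    (h1 : ∀ r : R, constantCoeff (φ r) = ι (IsLocalRing.residue O (Subring.inclusion hR r)))
    {y : R} (hy : y ∈ Ideal.comap (Subring.inclusion hR) (maximalIdeal O)) :
    constantCoeff (φ y) = 0 := by
  rw [h1, (IsLocalRing.residue_eq_zero_iff _).mpr (Ideal.mem_comap.mp hy), map_zero]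

/-- **T2a — the point `ξ ∈ κ^d` of the exceptional divisor through which `O` passes.** Let
`φ : R → κ⟦X_1..X_d⟧` be a formal chart (FC1: constant coefficients are residues; FC2: the centre
`𝔠 = 𝔪_O ∩ R` generates `(X)`), let `u_1, …, u_d` generate `𝔠`, and let `x` divide (in `O`) every
element of `𝔠`. Then there is a UNIQUE-BY-CONSTRUCTION `ξ ∈ κ^d` with
`Σ_l [X_l](φ y) · ξ_l = res(y/x)` for every `y ∈ 𝔠` — the residue functional `y ↦ res(y/x)` read through
the linear parts of the chart. (The matrix of linear parts of `φ u_m` is invertible by FC2, so `ξ` is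
the solution of `d` linear equations.) [folklore] -/
theorem exists_point
    (h1 : ∀ r : R, constantCoeff (φ r) = ι (IsLocalRing.residue O (Subring.inclusion hR r)))
    (h2 : Ideal.map φ (Ideal.comap (Subring.inclusion hR) (maximalIdeal O)) =
      Ideal.span (Set.range (X : Fin d → MvPowerSeries (Fin d) κ)))
    (u : Fin d → R) (hu : Ideal.span (Set.range u) = Ideal.comap (Subring.inclusion hR) (maximalIdeal O))
    (x : K) (hxO : ∀ y : R, y ∈ Ideal.comap (Subring.inclusion hR) (maximalIdeal O) → (y : K) / x ∈ O) :
    ∃ ξ : Fin d → κ, ∀ (y : R) (hy : y ∈ Ideal.comap (Subring.inclusion hR) (maximalIdeal O)),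
      ∑ l, coeff (Finsupp.single l 1) (φ y) * ξ l = ι (IsLocalRing.residue O ⟨(y : K) / x, hxO y hy⟩) := by
  classical
  set 𝔠 := Ideal.comap (Subring.inclusion hR) (maximalIdeal O) with h𝔠
  have hum : ∀ m, u m ∈ 𝔠 := fun m => by rw [← hu]; exact Ideal.subset_span ⟨m, rfl⟩
  have hu0 : ∀ m, constantCoeff (φ (u m)) = 0 :=
    fun m => constantCoeff_eq_zero_of_mem_centre O ι hR φ h1 (hum m)
  -- (a) the variables are combinations of the `φ u_m`
  have hX : ∀ l : Fin d, ∃ c : Fin d → MvPowerSeries (Fin d) κ, ∑ m, c m * φ (u m) = X l := by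
    intro l
    have hmem : (X l : MvPowerSeries (Fin d) κ) ∈ Ideal.map φ 𝔠 :=
      h2 ▸ Ideal.subset_span ⟨l, rfl⟩
    rw [← hu, Ideal.map_span, ← Set.range_comp] at hmem
    exact Ideal.mem_span_range_iff_exists_fun.mp hmem
  choose c hc using hX
  -- (b) the linear-part matrix `M` and its left inverse `Cm`
  let M : Matrix (Fin d) (Fin d) κ := fun m s => coeff (Finsupp.single s 1) (φ (u m))
  let Cm : Matrix (Fin d) (Fin d) κ := fun l m => constantCoeff (c l m)
  have hCM : Cm * M = 1 := by
    ext l s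
    have := congrArg (coeff (Finsupp.single s 1)) (hc l)
    rw [coeff_single_sum_mul s (c l) (fun m => φ (u m)) hu0, coeff_single_X] at this
    rw [Matrix.mul_apply, Matrix.one_apply]
    exact this
  have hMC : M * Cm = 1 := mul_eq_one_comm.mp hCM
  -- (c) the point
  let lam : Fin d → κ := fun m => ι (IsLocalRing.residue O ⟨((u m : R) : K) / x, hxO (u m) (hum m)⟩)
  refine ⟨Cm.mulVec lam, fun y hy => ?_⟩
  have hsol : ∀ m, ∑ l, M m l * Cm.mulVec lam l = lam m := by
    intro m
    have := congrFun (congrArg (fun A : Matrix (Fin d) (Fin d) κ => A.mulVec lam) hMC) m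
    simp only [← Matrix.mulVec_mulVec, Matrix.one_mulVec] at this
    rw [← this, Matrix.mulVec]
    rfl
  -- (d) write `y = Σ r_m u_m`
  have hy' : y ∈ Ideal.span (Set.range u) := hu ▸ hy
  obtain ⟨r, hr⟩ := Ideal.mem_span_range_iff_exists_fun.mp hy'
  -- linear parts of `φ y`
  have hlin : ∀ l, coeff (Finsupp.single l 1) (φ y) =
      ∑ m, ι (IsLocalRing.residue O (Subring.inclusion hR (r m))) * M m l := by
    intro l
    rw [← hr, map_sum]
    simp only [map_mul]
    rw [coeff_single_sum_mul l (fun m => φ (r m)) (fun m => φ (u m)) hu0]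
    exact Finset.sum_congr rfl fun m _ => by rw [h1]
  -- residue of `y / x`
  have hres : ι (IsLocalRing.residue O ⟨(y : K) / x, hxO y hy⟩) =
      ∑ m, ι (IsLocalRing.residue O (Subring.inclusion hR (r m))) * lam m := by
    have hyK : (y : K) = ∑ m, ((r m : R) : K) * ((u m : R) : K) := by
      rw [← hr, AddSubmonoidClass.coe_finsetSum]
      simp only [Subring.coe_mul]
    have heq : (⟨(y : K) / x, hxO y hy⟩ : O) =
        ∑ m, Subring.inclusion hR (r m) * ⟨((u m : R) : K) / x, hxO (u m) (hum m)⟩ := by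
      apply Subtype.ext
      show (y : K) / x = _
      rw [hyK, Finset.sum_div, AddSubmonoidClass.coe_finsetSum]
      refine Finset.sum_congr rfl fun m _ => ?_
      rw [MulMemClass.coe_mul, mul_div_assoc]
      rfl
    rw [heq, map_sum, map_sum]
    simp only [map_mul]
    rfl
  rw [hres]
  simp only [hlin, Finset.sum_mul]
  rw [Finset.sum_comm]
  refine Finset.sum_congr rfl fun m _ => ?_
  simp only [mul_assoc, ← Finset.mul_sum, hsol m]

end Point

end ChartStep

end Summit.ResolutionOfSingularities.ResolutionOfSingularities.Theorems.SwitchingDichotomy
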